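import Literature.Analysis.FluidPDE.DriftHeatTwoPointHarnack
import Literature.Analysis.FluidPDE.ParabolicHarnackDriftGap
import Literature.Analysis.FluidPDE.ParabolicLocalEstimatesProofs
import Literature.Analysis.FluidPDE.ParabolicWeakHarnackProofs
import HarnessLib

/-!
# Lieberman 1996, Theorem 6.27 with the waiting time (`Lieberman1996_harnack_drift_gap`) from
# the two-point Harnack inequality: reduction to Corollary 6.24

Analysis/FluidPDE proofs file (theorems only) on the discharge path of the named fact
`Literature.Analysis.FluidPDE.Lieberman1996_harnack_drift_gap` (`ParabolicHarnackDriftGap`: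
G. M. Lieberman, *Second Order Parabolic Differential Equations* (1996), Ch. VI §7,
**Theorem 6.27**, "If `u ∈ V` satisfies `Lu = 0` and is nonnegative in `Q(4R)`, then
`sup_{Θ(R/2)} u ≤ C inf_{Q(R)} u`", for `uₜ + a·∇u − Δu = 0` with bounded measurable drift, with
`Θ(R/2) = Q((y, s − 4R²), R/2) = B(y, R/2) × (s − 17R²/4, s − 4R²)` and
`Q(R) = B(y, R) × (s − R², s)`).

The book derives Theorem 6.27 "from Theorems 6.17 and 6.18" (p. 127). In the tree, Theorem 6.17
(the local maximum principle) is the named fact `Lieberman1996_local_max`, **discharged** by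
`Lieberman1996_local_max_holds` (`ParabolicLocalEstimatesProofs`), the flexible-cylinder form of
Theorem 6.18 (Corollary 6.24, the weak Harnack inequality) is the named fact
`Lieberman1996_weak_harnack` (`ParabolicLocalEstimates`), and `exists_twoPointHarnack`
(`DriftHeatTwoPointHarnack`) assembles from the two a *two-point Harnack inequality with time
lag* `γR²` inside the top slab of a positivity cylinder (`IsTwoPointHarnackConst E A R₀ γ C`).
This file closes the remaining, purely geometric, step:

* `IsTwoPointHarnackConst.chain_of_nonneg_on` — the Harnack chain (Lieberman, proof of
  Theorem 2.7 / Theorem 6.25, "the chaining argument") for a solution that is nonnegative only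
  on a region `(t_lo, t_hi) × B(y, ρ)` containing all the cylinders of the chain (the tree's
  `IsTwoPointHarnackConst.chain` asks for nonnegativity on all of `(0, T] × Ω`);
* `Lieberman1996_harnack_drift_gap_of_twoPoint` — **Theorem 6.27 with the waiting time from
  two-point Harnack constants with lag parameter `γ = 1/2`**: a point `(t₁, x₁)` of
  `Θ(R/2)` is joined to a point `(t₂, x₂)` of `Q(R)` by the chain of `24` equal time steps
  `ℓ = (t₂ − t₁)/24 ∈ (R²/8, 17R²/96)` along the segment `Zᵢ = x₁ + (i/24)(x₂ − x₁) ⊆ B(y, R)`,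
  run at radius `R/2` (cylinders `Q((Zᵢ, σᵢ₊₁ + δ), 2R) ⊆ Q((y, s), 4R)`,
  `δ = min((s − t₂)/2, R²/16)`, so that both `σᵢ = t₁ + iℓ` and `σᵢ₊₁` lie in the top slab of
  height `(R/2)²` because `ℓ + δ < R²/4`, and the lag `ℓ ≥ (1/2)(R/2)²`); the constant is `C²⁴`;
* `Lieberman1996_harnack_drift_gap_of_local_estimates` — Theorem 6.27 (with the waiting time)
  from Theorem 6.17 and Corollary 6.24, as the book says;
* `Lieberman1996_harnack_drift_gap_of_weak_harnack` — hence from Corollary 6.24 alone, Theorem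
  6.17 being discharged.

Consequently the **discharge** `Lieberman1996_harnack_drift_gap_holds` (last declaration of this
file, 2026-08-16) is the one-liner
`Lieberman1996_harnack_drift_gap_of_weak_harnack Lieberman1996_weak_harnack_holds`, the weak
Harnack inequality being discharged in `ParabolicWeakHarnackProofs`
(`Lieberman1996_weak_harnack_holds`, imported for this purpose only); no further input is needed.
This closes Lieberman's Theorem 6.27 for `uₜ + a·∇u − Δu = 0` with bounded measurable drift in
its corrected rendering (the gapless rendering `Lieberman1996_harnack_drift` of
`ParabolicHarnackDrift` is refuted, `not_Lieberman1996_harnack_drift`, and deprecated).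

## References

* G. M. Lieberman, *Second Order Parabolic Differential Equations*, World Scientific (1996),
  Ch. II proof of Thm 2.7 (chaining); Ch. VI §6 Theorem 6.17, Theorem 6.18, Corollary 6.24,
  definition of `Θ(R)` (p. 122); §7 Theorems 6.25, 6.27 (p. 127). [Lieberman1996]
* J. Moser, *A Harnack inequality for parabolic differential equations*, Comm. Pure Appl. Math.
  17 (1964) 101–134.
-/

noncomputable section

open MeasureTheory Set Function Metric InnerProductSpace
open scoped Laplacian

namespace Literature.Analysis.FluidPDE

variable {E : Type*} [NormedAddCommGroup E] [InnerProductSpace ℝ E] [FiniteDimensional ℝ E]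
  [MeasurableSpace E]

/-! ### Harnack chains inside one positivity region -/

section Chain

variable {A R₀ γ C : ℝ} {Ω : Set E} {T : ℝ} {a : ℝ → E → E} {u : ℝ → E → ℝ}

/-- **Harnack chain inside a positivity region** (Lieberman 1996, the chaining argument of the
proof of Theorem 2.7, invoked in Theorem 6.25): let `C` be a two-point Harnack constant with
lag `γ` for drift bound `A` and radii `≤ R₀`, let `u` be a member of the elementary class on
`(0, T] × Ω` which is nonnegative on `(t_lo, t_hi) × B(y, ρ)`, and let `(σ₀, Z₀), …, (σₙ, Zₙ)`
be space-time points with `|Zᵢ₊₁ − Zᵢ| < R`, `B̄(Zᵢ, 4R) ⊆ Ω`, `B(Zᵢ, 4R) ⊆ B(y, ρ)`, lags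
`σᵢ₊₁ − σᵢ ≥ γR²`, such that each consecutive pair of times lies in the top slab
`(sᵢ − R², sᵢ)` of a cylinder `Q((Zᵢ, sᵢ), 4R) ⊆ (t_lo, t_hi) × B(y, ρ)` with
`16R² < sᵢ ≤ T`. Then `u(σ₀, Z₀) ≤ Cⁿ u(σₙ, Zₙ)`. [cite: Lieberman1996, Ch. II proof of Thm 2.7 (chaining), Ch. VI Thm 6.25] -/
theorem IsTwoPointHarnackConst.chain_of_nonneg_on (hC : IsTwoPointHarnackConst E A R₀ γ C)
    (hC0 : 0 ≤ C) (hΩ : IsOpen Ω) (ham : Measurable (uncurry a))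
    (haA : ∀ t ∈ Ioc 0 T, ∀ x ∈ Ω, ‖a t x‖ ≤ A) (hu2 : ∀ t ∈ Ioc 0 T, ContDiffOn ℝ 2 (u t) Ω)
    (hDu : ContinuousOn (fun p : ℝ × E => fderiv ℝ (u p.1) p.2) (Ioc 0 T ×ˢ Ω))
    (hΔu : ContinuousOn (fun p : ℝ × E => (Δ (u p.1)) p.2) (Ioc 0 T ×ˢ Ω))
    (hequ : ∀ x ∈ Ω, ∀ s t : ℝ, 0 < s → s ≤ t → t ≤ T →
      u t x - u s x = ∫ r in s..t, ((Δ (u r)) x - fderiv ℝ (u r) x (a r x)))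
    {y : E} {ρ tlo thi : ℝ} (hpos : ∀ t ∈ Ioo tlo thi, ∀ x ∈ ball y ρ, 0 ≤ u t x)
    {R : ℝ} (hR : 0 < R) (hRR₀ : R ≤ R₀) (Z : ℕ → E) (σ : ℕ → ℝ) (n : ℕ)
    (hZ : ∀ i < n, dist (Z (i + 1)) (Z i) < R)
    (hZΩ : ∀ i < n, closedBall (Z i) (4 * R) ⊆ Ω)
    (hZy : ∀ i < n, ball (Z i) (4 * R) ⊆ ball y ρ)
    (hlag : ∀ i < n, γ * R ^ 2 ≤ σ (i + 1) - σ i)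
    (htop : ∀ i < n, ∃ s : ℝ, 16 * R ^ 2 < s ∧ s ≤ T ∧ tlo ≤ s - 16 * R ^ 2 ∧ s ≤ thi ∧
      σ i ∈ Ioo (s - R ^ 2) s ∧ σ (i + 1) ∈ Ioo (s - R ^ 2) s) :
    u (σ 0) (Z 0) ≤ C ^ n * u (σ n) (Z n) := by
  induction n with
  | zero => simp
  | succ n ih =>
    have h1 := ih (fun i hi => hZ i (by omega)) (fun i hi => hZΩ i (by omega))
      (fun i hi => hZy i (by omega)) (fun i hi => hlag i (by omega))
      (fun i hi => htop i (by omega))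
    obtain ⟨s, hs, hsT, hslo, hshi, hσ, hσ'⟩ := htop n (by omega)
    have hposn : ∀ t ∈ Ioo (s - 16 * R ^ 2) s, ∀ z ∈ ball (Z n) (4 * R), 0 ≤ u t z :=
      fun t ht z hz => hpos t ⟨lt_of_le_of_lt hslo ht.1, lt_of_lt_of_le ht.2 hshi⟩ z
        (hZy n (by omega) hz)
    have h2 : u (σ n) (Z n) ≤ C * u (σ (n + 1)) (Z (n + 1)) :=
      hC hΩ ham haA hu2 hDu hΔu hequ hR hRR₀ (hZΩ n (by omega)) hs hsT hposn hσ
        (mem_ball_self hR) hσ' (hZ n (by omega)) (hlag n (by omega))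
    calc u (σ 0) (Z 0) ≤ C ^ n * u (σ n) (Z n) := h1
      _ ≤ C ^ n * (C * u (σ (n + 1)) (Z (n + 1))) := mul_le_mul_of_nonneg_left h2 (pow_nonneg hC0 n)
      _ = C ^ (n + 1) * u (σ (n + 1)) (Z (n + 1)) := by rw [pow_succ]; ring

end Chain

/-! ### Theorem 6.27 with the waiting time from the two-point Harnack inequality -/

section Gap

variable (E)

/-- **Lieberman 1996, Theorem 6.27 (with the waiting time) from two-point Harnack constants.**
If for every drift bound `A` and every `R₀ > 0` there is a two-point Harnack constant `C ≥ 1`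
with lag parameter `γ = 1/2` for radii `≤ R₀` (`IsTwoPointHarnackConst E A R₀ (1/2) C`:
`u(t₁, x₁) ≤ C u(t₂, x₂)` for `x₁, x₂ ∈ B(y', R')`, `t₁, t₂ ∈ (s' − R'², s')`,
`t₂ − t₁ ≥ R'²/2`, whenever `u ≥ 0` on `Q((y', s'), 4R')`, `R' ≤ R₀`), then
`Lieberman1996_harnack_drift_gap E` holds, with the constant `C²⁴`: a point of
`Θ(R/2) = B(y, R/2) × (s − 17R²/4, s − 4R²)` is joined to a point of `Q(R) = B(y, R) × (s − R², s)`
by `24` steps of equal lag `(t₂ − t₁)/24 ∈ (R²/8, 17R²/96)` along the segment from `x₁` to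
`x₂`, each step a two-point comparison at radius `R/2` in a cylinder
`Q((Zᵢ, σᵢ₊₁ + δ), 2R) ⊆ Q((y, s), 4R)` (module docstring). [cite: Lieberman1996, Ch. VI Thm 6.27 with Thm 6.25 (chaining)] -/
theorem Lieberman1996_harnack_drift_gap_of_twoPoint
    (h : ∀ A : ℝ, ∀ ⦃R₀ : ℝ⦄, 0 < R₀ → ∃ C : ℝ, 1 ≤ C ∧ IsTwoPointHarnackConst E A R₀ (1 / 2) C) :
    Lieberman1996_harnack_drift_gap E := by
  intro A R₀ hR₀
  obtain ⟨C, hC1, hC⟩ := h A hR₀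
  have hCpos : 0 < C := zero_lt_one.trans_le hC1
  refine ⟨C ^ 24, pow_pos hCpos 24, ?_⟩
  intro Ω T a u hΩ ham haA hu2 hDu hΔu hequ y s R hR hRR₀ hB hs hsT hpos t₁ x₁ t₂ x₂ ht₁ hx₁ ht₂ hx₂
  have hR2 : 0 < R ^ 2 := by positivity
  have hR'sq : (R / 2) ^ 2 = R ^ 2 / 4 := by ring
  -- the time step `ℓ`, the overshoot `δ` of the tops, the times `σ i` and the points `Z i`
  obtain ⟨ℓ, hℓ⟩ : ∃ ℓ : ℝ, ℓ = (t₂ - t₁) / 24 := ⟨_, rfl⟩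
  have hℓlo : R ^ 2 / 8 < ℓ := by rw [hℓ]; linarith only [ht₁.2, ht₂.1]
  have hℓhi : ℓ < 17 / 96 * R ^ 2 := by rw [hℓ]; linarith only [ht₁.1, ht₂.2]
  have hℓ0 : 0 < ℓ := by linarith only [hℓlo, hR2]
  obtain ⟨δ, hδ⟩ : ∃ δ : ℝ, δ = min ((s - t₂) / 2) (R ^ 2 / 16) := ⟨_, rfl⟩
  have hδ0 : 0 < δ := by rw [hδ]; exact lt_min (by linarith only [ht₂.2]) (by positivity)
  have hδ1 : δ ≤ (s - t₂) / 2 := by rw [hδ]; exact min_le_left _ _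
  have hδ2 : δ ≤ R ^ 2 / 16 := by rw [hδ]; exact min_le_right _ _
  obtain ⟨σ, hσ⟩ : ∃ σ : ℕ → ℝ, σ = fun i : ℕ => t₁ + (i : ℝ) * ℓ := ⟨_, rfl⟩
  obtain ⟨Z, hZ⟩ : ∃ Z : ℕ → E, Z = fun i : ℕ => x₁ + ((i : ℝ) / 24) • (x₂ - x₁) := ⟨_, rfl⟩
  have hσ0 : σ 0 = t₁ := by simp [hσ]
  have hσ24 : σ 24 = t₂ := by simp only [hσ, hℓ]; push_cast; ring
  have hZ0 : Z 0 = x₁ := by simp [hZ]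
  have hZ24 : Z 24 = x₂ := by
    simp only [hZ]
    rw [Nat.cast_ofNat, div_self (by norm_num : (24 : ℝ) ≠ 0), one_smul]
    abel
  have hσsucc : ∀ i : ℕ, σ (i + 1) = σ i + ℓ := by
    intro i; simp only [hσ]; push_cast; ring
  have hσge : ∀ i : ℕ, t₁ ≤ σ i := by
    intro i
    have hi0 : (0 : ℝ) ≤ i := Nat.cast_nonneg i
    simp only [hσ]
    nlinarith only [hi0, hℓ0]
  have hσle : ∀ i < 24, σ (i + 1) ≤ t₂ := by
    intro i hi
    have hi24 : ((i + 1 : ℕ) : ℝ) ≤ 24 := by exact_mod_cast Nat.succ_le_of_lt hi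
    rw [← hσ24]
    simp only [hσ]
    push_cast at hi24 ⊢
    nlinarith only [hi24, hℓ0]
  -- the points of the segment lie in `B(y, R)`, consecutive ones are `R/16`-close
  have hx₁R : x₁ ∈ ball y R := ball_subset_ball (by linarith only [hR]) hx₁
  have hZmem : ∀ i ≤ 24, Z i ∈ ball y R := by
    intro i hi
    have hi' : (i : ℝ) / 24 ∈ Icc (0 : ℝ) 1 :=
      ⟨by positivity, by rw [div_le_one (by norm_num)]; exact_mod_cast hi⟩
    simp only [hZ]
    exact (convex_ball y R).add_smul_sub_mem hx₁R hx₂ hi'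
  have hdist : ∀ i : ℕ, dist (Z (i + 1)) (Z i) < R / 2 := by
    intro i
    have e : Z (i + 1) - Z i = (1 / 24 : ℝ) • (x₂ - x₁) := by
      simp only [hZ]
      rw [Nat.cast_succ, add_sub_add_left_eq_sub, ← sub_smul]
      congr 1
      ring
    have h12 : ‖x₂ - x₁‖ < 3 / 2 * R := by
      calc ‖x₂ - x₁‖ = dist x₂ x₁ := (dist_eq_norm _ _).symm
        _ ≤ dist x₂ y + dist x₁ y := dist_triangle_right _ _ _
        _ < R + R / 2 := add_lt_add (mem_ball.1 hx₂) (mem_ball.1 hx₁)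
        _ = 3 / 2 * R := by ring
    rw [dist_eq_norm, e, norm_smul, Real.norm_of_nonneg (by norm_num : (0 : ℝ) ≤ 1 / 24)]
    linarith only [h12, hR]
  -- the chain at radius `R/2`
  have hR' : 0 < R / 2 := by positivity
  have hR'R₀ : R / 2 ≤ R₀ := by linarith only [hRR₀, hR]
  have key := hC.chain_of_nonneg_on hCpos.le hΩ ham haA hu2 hDu hΔu hequ hpos hR' hR'R₀ Z σ 24
    (fun i _ => hdist i) ?_ ?_ ?_ ?_
  · rwa [hσ0, hZ0, hσ24, hZ24] at key
  · -- `B̄(Zᵢ, 2R) ⊆ B̄(y, 4R) ⊆ Ω`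
    intro i hi
    refine Subset.trans (closedBall_subset_closedBall' ?_) hB
    have := (mem_ball.1 (hZmem i (by omega))).le
    linarith only [this, hR]
  · -- `B(Zᵢ, 2R) ⊆ B(y, 4R)`
    intro i hi
    refine ball_subset_ball' ?_
    have := (mem_ball.1 (hZmem i (by omega))).le
    linarith only [this, hR]
  · -- the lag `ℓ ≥ (1/2)(R/2)²`
    intro i hi
    rw [hσsucc i]
    linarith only [hℓlo, hR'sq]
  · -- the tops `σᵢ₊₁ + δ`
    intro i hi
    have h1 := hσge i
    have h2 := hσle i hi
    have h3 := hσsucc i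
    refine ⟨σ (i + 1) + δ, ?_, ?_, ?_, ?_, ?_, ?_⟩
    · linarith only [hR'sq, h1, h3, ht₁.1, hs, hℓ0, hδ0, hR2]
    · linarith only [h2, hδ1, ht₂.2, hsT]
    · linarith only [hR'sq, h1, h3, ht₁.1, hℓ0, hδ0, hR2]
    · linarith only [h2, hδ1, ht₂.2]
    · rw [h3]
      constructor <;> linarith only [hR'sq, hℓhi, hδ2, hℓ0, hδ0, hR2]
    · constructor <;> linarith only [hR'sq, hδ2, hδ0, hR2]

/-- **Lieberman 1996, Theorem 6.27 (with the waiting time) from Theorem 6.17 and Corollary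
6.24** ("From Theorems 6.17 and Theorem 6.18, we also conclude a parabolic analog of Harnack's
inequality", p. 127): the two local estimates give two-point Harnack constants for every lag
parameter (`exists_twoPointHarnack`), in particular for `γ = 1/2`, and the chain of
`Lieberman1996_harnack_drift_gap_of_twoPoint` concludes. [cite: Lieberman1996, Ch. VI Thm 6.27 (from Thm 6.17, Cor 6.24)] -/
theorem Lieberman1996_harnack_drift_gap_of_local_estimates [BorelSpace E]
    (hLM : Lieberman1996_local_max E) (hWH : Lieberman1996_weak_harnack E) :
    Lieberman1996_harnack_drift_gap E :=
  Lieberman1996_harnack_drift_gap_of_twoPoint E fun A _ hR₀ =>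
    exists_twoPointHarnack (γ := 1 / 2) hLM hWH A hR₀ (by norm_num) (by norm_num)

/-- **Lieberman 1996, Theorem 6.27 (with the waiting time) from the weak Harnack inequality
(Corollary 6.24) alone**, the local maximum principle (Theorem 6.17) being discharged in the
tree (`Lieberman1996_local_max_holds`). [cite: Lieberman1996, Ch. VI Thm 6.27 (from Thm 6.17, Cor 6.24)] -/
theorem Lieberman1996_harnack_drift_gap_of_weak_harnack [BorelSpace E]
    (hWH : Lieberman1996_weak_harnack E) : Lieberman1996_harnack_drift_gap E :=
  Lieberman1996_harnack_drift_gap_of_local_estimates E (Lieberman1996_local_max_holds E) hWH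

variable [BorelSpace E] in
/-- **Discharge of `Lieberman1996_harnack_drift_gap` — Lieberman 1996, Theorem 6.27 (interior
parabolic Harnack inequality, with the waiting time) for `uₜ + a·∇u − Δu = 0` with bounded
measurable drift holds**, on every finite-dimensional real inner product space: Theorem 6.27 is
assembled, as the book says (p. 127, "From Theorems 6.17 and Theorem 6.18"), from the local
maximum principle (Theorem 6.17, `Lieberman1996_local_max_holds`) and the weak Harnack inequality
(Corollary 6.24, `Lieberman1996_weak_harnack_holds`) through the two-point Harnack inequality and
the chaining argument (`Lieberman1996_harnack_drift_gap_of_weak_harnack`).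
[cite: Lieberman1996, Ch. VI Thm 6.27 (p. 127; from Thm 6.17, Cor 6.24)] -/
theorem Lieberman1996_harnack_drift_gap_holds : Lieberman1996_harnack_drift_gap E :=
  Lieberman1996_harnack_drift_gap_of_weak_harnack E (Lieberman1996_weak_harnack_holds E)

end Gap

end Literature.Analysis.FluidPDE

end
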